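/-
Copyright (c) 2026 the pub-hodgecm-mathlib formalisation cell (harness21).  Prover seat hodgecm-mathlib-A-p17 (g20), floor 0, programme P5
(Alb-CM), in-house road for the letter L4if (ROAD CARD v4 §2 (iv), A-p18 (g24)), the scalar dictionary (§6) of recipe step 3.  KERNEL module:
THEOREMS ONLY (no definition, no named fact, no `sorry`, no instance, no notation).
-/
import Literature.NumberTheory.Automorphic.Liu2021.Def411IrreducibleOfLemD1AsPrinted
import Literature.NumberTheory.Automorphic.Liu2021.Def411WeilCarriersChiUnitary
import Literature.NumberTheory.Automorphic.UnitaryGroupLocalCenterScalar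
import Literature.NumberTheory.Automorphic.UnitaryGroupDualPairLocalLine
import Literature.NumberTheory.Automorphic.UnitaryGroupAdelicDet
import Literature.NumberTheory.Automorphic.NormOneIdeleClassCompact
import HarnessLib

/-!
# F0 · P5 pay-down line `Cruxes/HLiu418/Lines/F0_P5_CurveThetaLettersPaydown` (ED. 7), letter L4if, recipe step 3 — the SCALAR DICTIONARY:
# the multiplier `α₀((det k)_v) = χ((det k)_{v,f})` of B2-descended versus the multiplier `ξ(localUnitScalar (det g)⁻¹)` of (C4b)

Cell `hodgecm-mathlib`, floor 0, programme P5 (Alb-CM); crux item `stmt-HodgeConjecture-24832`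
(`Summit.HodgeConjecture.HodgeConjecture.Theses.HCCMUnconditional.HLiu418`).  Companion of `F0P5CurveThetaCompanionDetTwistCoinvariants` ∕
`F0P5CurveThetaCompanionGalConjCoinvariants` (step 3 of the in-house road for `Liu2021.LemD1RankTwoCMLetters.LemD1_4IfAsPrintedNonsplitCM₂`,
road cards `F0/P5/A-p18/g23/ROAD-L4if-v3.A-p18g23.md` §8 and `F0/P5/A-p18/g24/ROAD-L4if-v4.A-p18g24.md` §2 (iv)); independent of them
(Literature imports only).  The two det-twists that the assembler cancels in ROAD v4 §2 (iv) are written in two currencies: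

* B2 (★ `omegaLoc_localLineInl_eq_detTwist_smul_of_mul_ratioHecke`, and its descent) multiplies by `α((det k)_v)` with
  `(det k)_v = adelicDet … (finAdelicToAdelic … (inclPlace … v k)) ∈ U(1)(𝔸_F)` for `k ∈ U(J)(F_v)` in the factor form `localPi`, and the twist datum
  of the companion pair is `α₀(u) = χ₁(u_f)` for a character `χ₁` of `E¹(𝔸_{F,f})`;
* (C4b) (★ `exists_coinv_equiv_galConj_similitude_models`) multiplies by `ξ(localUnitScalar … (det (localPiEquiv g))⁻¹ …)` with `ξ = χ_{1,v} =
  localCharOfCenter … J₁ χ₁ v` the local component of `χ₁` on the centre line `U(J₁)(F_v) = E_v¹`.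

This file identifies them: (D0) `(det (1, g))_f = det g` in `(𝔸_{E,f})ˣ`; (D1)∕(D1′)∕(D2) the components of `det (inclPlace v k)` and of
`det (localPiEquiv k)` (`det k_w` over `v`, `1` elsewhere); (D3) **`det (inclPlace v k) = det (inclPlace v (localUnitScalar (det (localPiEquiv k))))`**;
(D4)∕(D5) **`χ₁((det k)_{v,f}) = χ_{1,v}(localUnitScalar (det (localPiEquiv k)))`** (★ `localCharOfCenter_eq_comp_inclPlace`); (D6)
`localUnitScalar z · localUnitScalar z⁻¹ = 1`; (D7) **the cancellation `χ₁((det k)_{v,f}) · χ_{1,v}(localUnitScalar (det (localPiEquiv k))⁻¹) = 1`**;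
(D8) `det (localPiEquiv (k ⊗ 1)) = det (localPiEquiv k)` along the dual-pair embedding `localLineInl` (a LINE `W`, any enumeration `e`).
Pure bookkeeping over the tree's place dictionary (`inclPlace`, `GLn.evalAt`, `GLn.piEquiv`, `finAdelicCenterInv`, `localUnitScalar`).

HONEST LABEL: HC_CM is proved only modulo the printed citations — the 2 remaining named inputs (hLiu418, h413) — until rung 0 closes; this
file proves helper lemmas toward ONE registered letter stub (L4if) of ONE floor-0 pay-down line and discharges no letter by itself.

## References
* [Liu2021] Y. Liu, *Fourier–Jacobi cycles and arithmetic relative trace formula*, Camb. J. Math. 9 (2021) = arXiv:2102.11518: App. D §D.1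
  Step 3 (l. 5221), Lem. D.1 (4) (p. 126, l. 5235).
* [GelbartRogawski1991] S. Gelbart, J. Rogawski, Invent. Math. 105 (1991), §3.1 Remark p. 457 L4–13, §3.2 p. 457.
* [Mok2014] C. P. Mok, Mem. AMS 235 (2015), §1 Notation p. 5.  [PlatonovRapinchuk1994] V. Platonov, A. Rapinchuk, *Algebraic Groups and Number
  Theory* (1994), §5.1.
-/

set_option autoImplicit false
set_option linter.dupNamespace false

noncomputable section

open NumberField IsDedekindDomain
open scoped Matrix Kronecker
open Literature.NumberTheory.Automorphic Literature.NumberTheory.Automorphic.UnitaryGroup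
open Literature.NumberTheory.GaloisRepresentations

namespace Summit.HodgeConjecture.HodgeConjecture.Cruxes.HLiu418.F0P5CurveThetaCompanionDetTwist

section DetDictionary

variable (F E : Type) [Field F] [NumberField F] [Field E] [NumberField E] [Algebra F E]
variable (c : E ≃ₐ[F] E) (N : ℕ) (J : Matrix (Fin N) (Fin N) E) (J₁ : Matrix (Fin 1) (Fin 1) E)

/-- **(D0) the finite part of `det (1, g)` is `det g`** for `g ∈ U(J)(𝔸_{F,f})` pushed to `U(J)(𝔸_F)` by `g ↦ (1, g)`.
[cite: Mok2014, §1 Notation p. 5] -/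
theorem finitePart_adelicDet_finAdelicToAdelic (hJ : J.det ≠ 0) (g : UnitaryGroup.finAdelic F E c N J) :
    finitePart E ((UnitaryGroup.adelicDet F E c N J hJ (UnitaryGroup.finAdelicToAdelic F E c N J g) :
        UnitaryGroup.adelicOne F E c) : ideleGroup E) =
      Matrix.GeneralLinearGroup.det (g : GL (Fin N) (FiniteAdeleRing (𝓞 E) E)) := by
  refine Units.ext ?_
  show adeleSnd E ((GLn.ofFinite N E (g : GL (Fin N) (FiniteAdeleRing (𝓞 E) E))).val.det) =
    (g : GL (Fin N) (FiniteAdeleRing (𝓞 E) E)).val.det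
  rw [RingHom.map_det, RingHom.mapMatrix_apply, map_snd_ofFinite]

/-- **(D1) the `w`-component of `det (inclPlace v k)` over `v` is `det k_w`.** [cite: PlatonovRapinchuk1994, §5.1] -/
theorem det_inclPlace_apply_of_over (v : HeightOneSpectrum (𝓞 F)) (k : UnitaryGroup.localPi E c N J v) (w : PlacesOver E v) :
    ((Matrix.GeneralLinearGroup.det (UnitaryGroup.inclPlace F E c N J v k).1 : (FiniteAdeleRing (𝓞 E) E)ˣ) :
        FiniteAdeleRing (𝓞 E) E) w.1 =
      (((k : LocalGLPi E N v) w : GL (Fin N) (w.1.adicCompletion E)) : Matrix (Fin N) (Fin N) (w.1.adicCompletion E)).det := by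
  rw [Matrix.GeneralLinearGroup.val_det_apply, ← AdelicGroupData.finiteAdeleEval_apply E w.1, RingHom.map_det, RingHom.mapMatrix_apply,
    map_eval_eq_evalAt, evalAt_inclPlace_of_over]

/-- **(D1′) the `w`-component of `det (inclPlace v k)` away from `v` is `1`.** [cite: PlatonovRapinchuk1994, §5.1] -/
theorem det_inclPlace_apply_of_not_over (v : HeightOneSpectrum (𝓞 F)) (k : UnitaryGroup.localPi E c N J v) (w : HeightOneSpectrum (𝓞 E))
    (hw : w.under (𝓞 F) ≠ v) :
    ((Matrix.GeneralLinearGroup.det (UnitaryGroup.inclPlace F E c N J v k).1 : (FiniteAdeleRing (𝓞 E) E)ˣ) :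
        FiniteAdeleRing (𝓞 E) E) w = 1 := by
  rw [Matrix.GeneralLinearGroup.val_det_apply, ← AdelicGroupData.finiteAdeleEval_apply E w, RingHom.map_det, RingHom.mapMatrix_apply,
    map_eval_eq_evalAt, evalAt_inclPlace_of_not_over F E c N J hw k ⟨w, rfl⟩, Units.val_one, Matrix.det_one]

/-- **(D2) the `w`-component of `det (localPiEquiv k)` is `det k_w`** (`GL_N(E_v) = Π_{w ∣ v} GL_N(E_w)`). [cite: PlatonovRapinchuk1994, §5.1] -/
theorem det_localPiEquiv_apply (v : HeightOneSpectrum (𝓞 F)) (k : UnitaryGroup.localPi E c N J v) (w : PlacesOver E v) :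
    ((Matrix.GeneralLinearGroup.det ((localPiEquiv E c N J v k : «local» E c N J v) : GL (Fin N) (LocalRing E v)) : (LocalRing E v)ˣ) :
        LocalRing E v) w =
      (((k : LocalGLPi E N v) w : GL (Fin N) (w.1.adicCompletion E)) : Matrix (Fin N) (Fin N) (w.1.adicCompletion E)).det := by
  rw [Matrix.GeneralLinearGroup.val_det_apply,
    ← Pi.evalRingHom_apply (fun w : PlacesOver E v => w.1.adicCompletion E) w (Matrix.det _), RingHom.map_det, RingHom.mapMatrix_apply,
    coe_localPiEquiv_apply, GLn.map_piEquiv_symm]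

/-- **(D3) THE DICTIONARY in `U(1)(𝔸_{F,f})`: `det (inclPlace v k) = det (inclPlace v (localUnitScalar (det k)))`** — the finite idèle `(det k)_v`
(component `det k_w` at `w ∣ v`, `1` elsewhere) presented through `U(J)` and through the centre line `U(J₁)`.
[cite: Mok2014, §1 Notation p. 5] [cite: PlatonovRapinchuk1994, §5.1] -/
theorem det_inclPlace_eq_det_inclPlace_localUnitScalar (v : HeightOneSpectrum (𝓞 F)) (k : UnitaryGroup.localPi E c N J v)
    (hz : ((Matrix.GeneralLinearGroup.det ((localPiEquiv E c N J v k : «local» E c N J v) : GL (Fin N) (LocalRing E v)) : (LocalRing E v)ˣ) :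
        LocalRing E v) * conjLocal E c v (Matrix.GeneralLinearGroup.det ((localPiEquiv E c N J v k : «local» E c N J v) :
          GL (Fin N) (LocalRing E v))) = 1) :
    Matrix.GeneralLinearGroup.det (UnitaryGroup.inclPlace F E c N J v k).1 =
      Matrix.GeneralLinearGroup.det (UnitaryGroup.inclPlace F E c 1 J₁ v
        (localUnitScalar E c J₁ v (Matrix.GeneralLinearGroup.det ((localPiEquiv E c N J v k : «local» E c N J v) :
          GL (Fin N) (LocalRing E v))) hz)).1 := by
  refine Units.ext (FiniteAdeleRing.ext E fun w => ?_)
  by_cases hw : w.under (𝓞 F) = v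
  · rw [det_inclPlace_apply_of_over F E c N J v k ⟨w, hw⟩, det_inclPlace_apply_of_over F E c 1 J₁ v _ ⟨w, hw⟩, Matrix.det_fin_one,
      coe_localUnitScalar_apply, det_localPiEquiv_apply]
  · rw [det_inclPlace_apply_of_not_over F E c N J v k w hw, det_inclPlace_apply_of_not_over F E c 1 J₁ v _ w hw]

/-- **(D4) in `E¹(𝔸_{F,f})`**: the finite part of `det (1, inclPlace v k) ∈ U(1)(𝔸_F)` IS `det (inclPlace v (localUnitScalar (det k)))` read through
`finAdelicCenterInv` — the element to which a centre character `χ₁` is applied on either side. [cite: Mok2014, §1 Notation p. 5] -/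
theorem finitePart_adelicDet_inclPlace_eq_finAdelicCenterInv (hJ : J.det ≠ 0) (hJ₁ : J₁ 0 0 ≠ 0) (v : HeightOneSpectrum (𝓞 F))
    (k : UnitaryGroup.localPi E c N J v)
    (hz : ((Matrix.GeneralLinearGroup.det ((localPiEquiv E c N J v k : «local» E c N J v) : GL (Fin N) (LocalRing E v)) : (LocalRing E v)ˣ) :
        LocalRing E v) * conjLocal E c v (Matrix.GeneralLinearGroup.det ((localPiEquiv E c N J v k : «local» E c N J v) :
          GL (Fin N) (LocalRing E v))) = 1) :
    (⟨finitePart E ((UnitaryGroup.adelicDet F E c N J hJ (UnitaryGroup.finAdelicToAdelic F E c N J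
        (UnitaryGroup.inclPlace F E c N J v k)) : UnitaryGroup.adelicOne F E c) : ideleGroup E),
        finitePart_mem_finAdelicOne F E c (UnitaryGroup.adelicDet F E c N J hJ (UnitaryGroup.finAdelicToAdelic F E c N J
          (UnitaryGroup.inclPlace F E c N J v k))).2⟩ : UnitaryGroup.finAdelicOne F E c) =
      finAdelicCenterInv F E c J₁ hJ₁ (UnitaryGroup.inclPlace F E c 1 J₁ v
        (localUnitScalar E c J₁ v (Matrix.GeneralLinearGroup.det ((localPiEquiv E c N J v k : «local» E c N J v) :
          GL (Fin N) (LocalRing E v))) hz)) := by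
  refine Subtype.ext ?_
  rw [coe_finAdelicCenterInv]
  exact (finitePart_adelicDet_finAdelicToAdelic F E c N J hJ _).trans (det_inclPlace_eq_det_inclPlace_localUnitScalar F E c N J J₁ v k hz)

/-- **(D5) CHARACTER FORM**: for a character `χ₁` of `E¹(𝔸_{F,f})`, `χ₁((det k)_{v,f}) = χ_{1,v}(localUnitScalar (det k))`, `χ_{1,v} = localCharOfCenter … J₁ χ₁ v`.
[cite: Liu2021, App. D §D.1 Step 3 (l. 5221)] [cite: Mok2014, §1 Notation p. 5] -/
theorem apply_finitePart_adelicDet_inclPlace_eq_localCharOfCenter (hJ : J.det ≠ 0) (hJ₁ : J₁ 0 0 ≠ 0)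
    (χ₁ : UnitaryGroup.finAdelicOne F E c →* ℂˣ) (v : HeightOneSpectrum (𝓞 F)) (k : UnitaryGroup.localPi E c N J v)
    (hz : ((Matrix.GeneralLinearGroup.det ((localPiEquiv E c N J v k : «local» E c N J v) : GL (Fin N) (LocalRing E v)) : (LocalRing E v)ˣ) :
        LocalRing E v) * conjLocal E c v (Matrix.GeneralLinearGroup.det ((localPiEquiv E c N J v k : «local» E c N J v) :
          GL (Fin N) (LocalRing E v))) = 1) :
    χ₁ ⟨finitePart E ((UnitaryGroup.adelicDet F E c N J hJ (UnitaryGroup.finAdelicToAdelic F E c N J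
        (UnitaryGroup.inclPlace F E c N J v k)) : UnitaryGroup.adelicOne F E c) : ideleGroup E),
        finitePart_mem_finAdelicOne F E c (UnitaryGroup.adelicDet F E c N J hJ (UnitaryGroup.finAdelicToAdelic F E c N J
          (UnitaryGroup.inclPlace F E c N J v k))).2⟩ =
      localCharOfCenter F E c J₁ hJ₁ χ₁ v
        (localUnitScalar E c J₁ v (Matrix.GeneralLinearGroup.det ((localPiEquiv E c N J v k : «local» E c N J v) :
          GL (Fin N) (LocalRing E v))) hz) := by
  rw [localCharOfCenter_eq_comp_inclPlace, MonoidHom.comp_apply, MonoidHom.comp_apply,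
    finitePart_adelicDet_inclPlace_eq_finAdelicCenterInv F E c N J J₁ hJ hJ₁ v k hz]

/-- **(D6) `localUnitScalar z · localUnitScalar z⁻¹ = 1`** in `U(J₁)(F_v)` (the `1 × 1` scalars multiply). [cite: Mok2014, §1 Notation p. 5] -/
theorem localUnitScalar_mul_localUnitScalar_inv (v : HeightOneSpectrum (𝓞 F)) (z : (LocalRing E v)ˣ)
    (hz : (z : LocalRing E v) * conjLocal E c v z = 1) (hz' : ((z⁻¹ : (LocalRing E v)ˣ) : LocalRing E v) * conjLocal E c v (z⁻¹ : (LocalRing E v)ˣ) = 1) :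
    localUnitScalar E c J₁ v z hz * localUnitScalar E c J₁ v z⁻¹ hz' = 1 := by
  refine Subtype.ext (funext fun w => Units.ext (Matrix.ext fun i j => ?_))
  obtain rfl : i = 0 := Subsingleton.elim _ _
  obtain rfl : j = 0 := Subsingleton.elim _ _
  rw [Subgroup.coe_mul, Pi.mul_apply, Units.val_mul, Matrix.mul_apply, Fin.sum_univ_one, coe_localUnitScalar_apply,
    coe_localUnitScalar_apply, ← Pi.mul_apply, ← Units.val_mul, mul_inv_cancel, Units.val_one, Pi.one_apply, Subgroup.coe_one,
    Pi.one_apply, Units.val_one, Matrix.one_apply_eq]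

/-- **(D7) THE CANCELLATION of ROAD v4 §2 (iv)**: `χ₁((det k)_{v,f}) · χ_{1,v}(localUnitScalar (det k)⁻¹) = 1` — the multiplier of ★ B2 descended
(`α₀((det k)_v)` with `α₀(u) = χ(u_f)`) times the multiplier of ★ (C4b) (`ξ(localUnitScalar (det g)⁻¹)`, `ξ = χ_v`) at the same local determinant.
[cite: Liu2021, App. D §D.1 Step 3 (l. 5221), Lem. D.1 (4) (l. 5235)] [cite: GelbartRogawski1991, §3.1 Remark p. 457 L4–13] -/
theorem apply_finitePart_adelicDet_inclPlace_mul_localCharOfCenter_inv (hJ : J.det ≠ 0) (hJ₁ : J₁ 0 0 ≠ 0)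
    (χ₁ : UnitaryGroup.finAdelicOne F E c →* ℂˣ) (v : HeightOneSpectrum (𝓞 F)) (k : UnitaryGroup.localPi E c N J v)
    (hz : ((Matrix.GeneralLinearGroup.det ((localPiEquiv E c N J v k : «local» E c N J v) : GL (Fin N) (LocalRing E v)) : (LocalRing E v)ˣ) :
        LocalRing E v) * conjLocal E c v (Matrix.GeneralLinearGroup.det ((localPiEquiv E c N J v k : «local» E c N J v) :
          GL (Fin N) (LocalRing E v))) = 1)
    (hz' : (((Matrix.GeneralLinearGroup.det ((localPiEquiv E c N J v k : «local» E c N J v) : GL (Fin N) (LocalRing E v)))⁻¹ :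
        (LocalRing E v)ˣ) : LocalRing E v) * conjLocal E c v ((Matrix.GeneralLinearGroup.det ((localPiEquiv E c N J v k : «local» E c N J v) :
          GL (Fin N) (LocalRing E v)))⁻¹ : (LocalRing E v)ˣ) = 1) :
    χ₁ ⟨finitePart E ((UnitaryGroup.adelicDet F E c N J hJ (UnitaryGroup.finAdelicToAdelic F E c N J
        (UnitaryGroup.inclPlace F E c N J v k)) : UnitaryGroup.adelicOne F E c) : ideleGroup E),
        finitePart_mem_finAdelicOne F E c (UnitaryGroup.adelicDet F E c N J hJ (UnitaryGroup.finAdelicToAdelic F E c N J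
          (UnitaryGroup.inclPlace F E c N J v k))).2⟩ *
      localCharOfCenter F E c J₁ hJ₁ χ₁ v
        (localUnitScalar E c J₁ v (Matrix.GeneralLinearGroup.det ((localPiEquiv E c N J v k : «local» E c N J v) :
          GL (Fin N) (LocalRing E v)))⁻¹ hz') = 1 := by
  rw [apply_finitePart_adelicDet_inclPlace_eq_localCharOfCenter F E c N J J₁ hJ hJ₁ χ₁ v k hz, ← map_mul,
    localUnitScalar_mul_localUnitScalar_inv, map_one]

variable {n : ℕ} (e : Fin N × Fin 1 ≃ Fin n) (JV : Matrix (Fin N) (Fin N) E) (JW : Matrix (Fin 1) (Fin 1) E)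

/-- **(D8) `det (k ⊗ 1) = det k`** at the place `v`: the local determinant is unchanged under the dual-pair embedding `localLineInl` (a LINE `W`).
[cite: GelbartRogawski1991, §3.2 p. 457] [cite: Mok2014, §1 Notation p. 5] -/
theorem det_localPiEquiv_localLineInl (v : HeightOneSpectrum (𝓞 F)) (k : UnitaryGroup.localPi E c N JV v) :
    Matrix.GeneralLinearGroup.det ((localPiEquiv E c n (Matrix.reindex e e (JV ⊗ₖ JW)) v
        (UnitaryGroup.localLineInl E c N e JV JW v k) : «local» E c n (Matrix.reindex e e (JV ⊗ₖ JW)) v) : GL (Fin n) (LocalRing E v)) =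
      Matrix.GeneralLinearGroup.det ((localPiEquiv E c N JV v k : «local» E c N JV v) : GL (Fin N) (LocalRing E v)) := by
  refine Units.ext (funext fun w => ?_)
  rw [det_localPiEquiv_apply, det_localPiEquiv_apply, coe_localLineInl, coe_localLineGL_apply, Matrix.det_reindex_self, Matrix.det_kronecker,
    Matrix.det_one, one_pow, mul_one, Fintype.card_fin, pow_one]

end DetDictionary

end Summit.HodgeConjecture.HodgeConjecture.Cruxes.HLiu418.F0P5CurveThetaCompanionDetTwist

end
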